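import Summits.QuantumAdvantage.QuantumAdvantage.Theses.SparsityDial
import Summits.QuantumAdvantage.QuantumAdvantage.Theorems.SparsityDialRung
import Summits.QuantumAdvantage.QuantumAdvantage.Theorems.AnchorDialOrbitInv

/-!
# ResponseDial — Theorems twin (tree landing, census lane decomp-qadv g10) of NODE «ResponseDial»

Verbatim content of the lens node file `run/shared/lean/pub/decomp-qadv/decomp-qadv-lens-2/g19/ResponseDial.lean` §1–§8 under the
`Theorems.ResponseDial` namespace (the node elaborates under `Theses.ResponseDial`); the `#print axioms` guard block is dropped (the gate records axioms).
Supports stmt-QuantumAdvantage-27656 (`Theses.SparsityDial.DenseGenericLoss3`); `antipodalLoss3` closes the §5 rung `Theorems.SparsityDial.AntipodalLoss3` of the landed SparsityDial twin BY NAME.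

# NODE «ResponseDial» (decomp-qadv-lens-2, gen 19; RESIDUAL MODE on `SparsityDial.DenseGenericLoss3` = D, stmt-27656)

Lens: structural dichotomy (special vs generic).  Dial phrase (new in the lineage V1–V20): **additivity of the deviation
field's RESPONSE along adjacent-pair-flip orbits** — flip the five separated pairs `{b_i, b_i+1}` in every sub-pattern
`ε ∈ {0,1}^5`; the strategy's deviation set responds ADDITIVELY at `x` if `dev(x^ε) = dev(x) Δ (Δ_{i ∈ ε} R_i)` for some
response sets `R_i` (`AddResp`).  Pointer-type readers (`d_j = x_{a(j)} ⊕ junk-free`), and more generally every field whose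
deviation indicators are `𝔽₂`-affine in the input, respond additively at every input.

## What is PROVED here (0 sorry)
* §1–§2 **THE ADDITIVE-RESPONSE ORBIT LAW** (`additive_orbit_loses`, `additive_loss_count`): for EVERY strategy (no
  degree hypothesis), every admissible site tuple and every odd `x` at which the response is additive, one of the 32
  orbit points loses; hence `#{odd, additively responding} ≤ 32 · #{odd losers}`.  Mechanism: along the orbit the kernel
  phases move by `c_k(x^ε) = c_k(x) + Σ_{i∈ε, b_i<k} ±1` (`cN_orbF_cast`); the win condition at the 32 points is an
  `𝔽₂`-linear system in the unknown phase-class pattern sets whose all-win instance is INFEASIBLE — witnessed by 32 dual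
  certificates (`certN`, one per sign vector, found by Gaussian elimination, checked by `decide` through `CertOK`).
* §4 **the lineage's BC5 rung `SparsityDial.AntipodalLoss3` is now a THEOREM** (`antipodalLoss3`, loss `≥ 1/32`):
  the antipodal family responds additively everywhere (`apStrat_addResp`).
* §6 **the dial**: `StabAdd e P` (cheaply additivizable: some gauge of degree `≤ (log₂N)^e`, some site tuple, a.e. odd
  input responds additively); piece A `AddLoss3` (cheaply additivizable low-degree strategies lose `≥ n⁻¹`) is a THEOREM
  (`addLoss3`); piece B = the residual `NonAddGenericLoss3` (D restricted to `¬ StabAdd (c+1) P`);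
  `closes : AddLoss3 → NonAddGenericLoss3 → DenseGenericLoss3` and the exact converse; hence
  `nonAdd_iff_dense : NonAddGenericLoss3 ↔ DenseGenericLoss3` OUTRIGHT.
* §7 a CERTIFIED-DENSE member on which the law is silent: the HALF-COUNTER family `hcStrat` (antipodal pointer on
  `[1, N/2)`, canonical guess toggled by the common counter `[#{odd i : x_i} ≡ 0 (3)]` elsewhere; degree 4):
  `hcStrat_not_polylogSparse` (E1 transfers to every family agreeing with `apStrat` on the first half:
  `not_polylogSparse_of_agree`), `halfCounterLoss3_of_dense : D → HalfCounterLoss3` (the residual's first rung, OPEN);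
  §8 `hcStrat_not_addResp`: it responds NON-additively at EVERY input along EVERY admissible orbit (zero gauge);
  `apStrat_stabAdd`: the antipodal family IS cheaply additivizable — the dial cuts inside the dense class.

## Honest classification (NODE OUTPUT CONTRACT)
This is a **LAW node, not a certified split**: piece A is DECIDED, so the residual B is EQUIVALENT to the target
modulo the theorem (`nonAdd_iff_dense`) — B is not strictly weaker than D in implicational strength; it is SMALLER in
extension (the target class shrinks to the non-additivizable dense fields, and the whole `𝔽₂`-affine-response world,
incl. every pointer family the lineage has used as a witness, is removed by a theorem).  Per the critic's LAW/LADDER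
doctrine no child route is requested; the memo `NODE-g19.md` records the re-typed residual, the closed rung, the new
open rung `HalfCounterLoss3`, and the two open ENGINE questions (E3: is `hcStrat` additivizable by a non-zero cheap gauge —
the continuant automaton; CM: does the orbit-certificate method extend to common-mode mod-3 counter toggles at `F ≥ 8`). -/

set_option linter.dupNamespace false
noncomputable section
open scoped Classical

namespace Summit.QuantumAdvantage.QuantumAdvantage.Theorems.ResponseDial
open Finset
open Literature.Computability.QuantumComplexity Literature.Computability.QuantumComplexity.RingHLF
open Literature.Computability.MetaComplexity Literature.Computability.MetaComplexity.Smolensky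
open Summit.QuantumAdvantage.AdviceFreeQNC0
open Summit.QuantumAdvantage.QuantumAdvantage.Theorems.AnchorDial (outB dev cN orbF orbL orbL_cons fz
  cN_orbF_cast oddZeros_orbF win_iff gCond_iff_cN card_filter_orbF orbF_false flip2 card_odd_ge loss_shape_mono)
open Summit.QuantumAdvantage.QuantumAdvantage.Theorems.AnchorDial.Core (ct sg)
open Summit.QuantumAdvantage.QuantumAdvantage.Theorems.HolonomyDial (gCond tPoly tPoly_apply tPoly_mem card_odd_le
  xorP xorP_mem xorP_apply_bool mono_singleton_apply indP indP_mem indP_apply)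
open Summit.QuantumAdvantage.QuantumAdvantage.Theorems.StabilizerDial (apIdx apStrat apStrat_mem bitP bitP_apStrat
  pad rel_pad_iff outB_pad_zero pad_mem StabFew rowMask bitP_pad mem_dev_pad_apStrat_iff BlockRec
  blockSelect_of_fewLocus goodBound_of_blockRec fibreIdentityAt_of_block oddSliceBound_holds eventually_polylog
  side_bounds)
open Summit.QuantumAdvantage.QuantumAdvantage.Theorems.LocusDial (Coverable FewLocus)
open Summit.QuantumAdvantage.QuantumAdvantage.Theorems.SparsityDial (real_loss_of_frac AntipodalLoss3 stabFew_mono_mr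
  one_le_logpow)
open Summit.QuantumAdvantage.QuantumAdvantage.Theses.SparsityDial (DenseGenericLoss3)

/-! ## §1  The finite core: dual certificates for the additive-response orbit system (F = 5 flips). -/

section Core

/-- orbit point number `j < 32` as a flip-flag vector. -/
def εOf (j : ℕ) (i : Fin 5) : Bool := Nat.testBit j i.val

/-- the `𝔽₃` phase shift seen at orbit point `ε` by a position that has passed the first `g` flip sites, for the
sign vector `z` (`ct e s = [e]·(1+[s])`; a passed site acts with the complemented sign, `cN_orbF_cast`). -/
def sF (z ε : Fin 5 → Bool) (g : ℕ) : ZMod 3 :=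
  ct (ε 0) (xor (z 0) (decide (0 < g))) + ct (ε 1) (xor (z 1) (decide (1 < g))) +
    ct (ε 2) (xor (z 2) (decide (2 < g))) + ct (ε 3) (xor (z 3) (decide (3 < g))) +
    ct (ε 4) (xor (z 4) (decide (4 < g)))

/-- the dual certificates (bitmasks over the 32 orbit points), one per sign vector (found by Gaussian elimination
over `𝔽₂`; each has 21 points; the solution is unique up to the all-win-irrelevant kernel). -/
def certN : Bool → Bool → Bool → Bool → Bool → ℕ
  | false, false, false, false, false => 3067833782
  | false, false, false, false, true => 3681381814
  | false, false, false, true, false => 3686184557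
  | false, false, false, true, true => 3060652982
  | false, false, true, false, false => 3597385174
  | false, false, true, false, true => 3184973419
  | false, false, true, true, false => 3177933782
  | false, false, true, true, true => 3602738134
  | false, true, false, false, false => 3917387753
  | false, true, false, false, true => 2548689278
  | false, true, false, true, false => 3919026046
  | false, true, false, true, true => 2541676951
  | false, true, true, false, false => 2665970078
  | false, true, true, false, true => 3883497886
  | false, true, true, true, false => 3885932153
  | false, true, true, true, true => 2658789278
  | true, false, false, false, false => 2658789278
  | true, false, false, false, true => 3885932153
  | true, false, false, true, false => 3883497886
  | true, false, false, true, true => 2665970078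
  | true, false, true, false, false => 2541676951
  | true, false, true, false, true => 3919026046
  | true, false, true, true, false => 2548689278
  | true, false, true, true, true => 3917387753
  | true, true, false, false, false => 3602738134
  | true, true, false, false, true => 3177933782
  | true, true, false, true, false => 3184973419
  | true, true, false, true, true => 3597385174
  | true, true, true, false, false => 3060652982
  | true, true, true, false, true => 3686184557
  | true, true, true, true, false => 3681381814
  | true, true, true, true, true => 3067833782
/-- the certificate's orbit points for the sign vector `z`. -/
def lam (z : Fin 5 → Bool) : List ℕ :=
  (List.range 32).filter fun j => (certN (z 0) (z 1) (z 2) (z 3) (z 4)).testBit j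

/-- what a certificate must satisfy: odd size; for every (group, phase) the exclusion count over it is even; the
same restricted to the points where flag `i` is set (one condition per responding site and group). -/
abbrev CertOK (z : Fin 5 → Bool) (Λ : List ℕ) : Prop :=
  Λ.length % 2 = 1 ∧
    (∀ g : Fin 6, ∀ c : ZMod 3, (Λ.countP fun j => decide (c + sF z (εOf j) g.val ≠ 2)) % 2 = 0) ∧
    (∀ i : Fin 5, ∀ g : Fin 6, ∀ c : ZMod 3,
      (Λ.countP fun j => εOf j i && decide (c + sF z (εOf j) g.val ≠ 2)) % 2 = 0)

/-- **CORE (finite check, `decide`)**: every sign vector has a certificate. -/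
theorem certOK_lam5 : ∀ z₀ z₁ z₂ z₃ z₄ : Bool, CertOK ![z₀, z₁, z₂, z₃, z₄] (lam ![z₀, z₁, z₂, z₃, z₄]) := by
  intro z₀ z₁ z₂ z₃ z₄
  cases z₀ <;> cases z₁ <;> cases z₂ <;> cases z₃ <;> cases z₄ <;> decide

/-- ResponseDialA helper `eq_vec5` (decomp-qadv land package; see the module docstring). -/
theorem eq_vec5 (z : Fin 5 → Bool) : z = ![z 0, z 1, z 2, z 3, z 4] := by
  ext i; fin_cases i <;> rfl

/-- ResponseDialA helper `certOK_lam` (decomp-qadv land package; see the module docstring). -/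
theorem certOK_lam (z : Fin 5 → Bool) : CertOK z (lam z) := by
  rw [eq_vec5 z]; exact certOK_lam5 _ _ _ _ _

end Core

/-! ## §2  THE ADDITIVE-RESPONSE ORBIT LAW.  Along the 32-point orbit of five separated adjacent pair-flips, a
strategy whose deviation set responds ADDITIVELY (`dev(x^ε) = dev(x) Δ Δ_{ε_i=1} R_i`) loses at some orbit point. -/

section Law
variable {N : ℕ}

/-- ResponseDialA helper `mod3_ne_two` (decomp-qadv land package; see the module docstring). -/
theorem mod3_ne_two (n : ℕ) : n % 3 ≠ 2 ↔ ((n : ℕ) : ZMod 3) ≠ 2 := by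
  rw [ne_eq, ne_eq, not_iff_not]
  constructor
  · intro h; rw [← ZMod.natCast_mod n 3, h]; rfl
  · intro h
    have h' := congrArg ZMod.val h
    rw [ZMod.val_natCast] at h'
    exact h'

/-- ResponseDialA helper `castZ2_of_mod_eq_zero` (decomp-qadv land package; see the module docstring). -/
theorem castZ2_of_mod_eq_zero {n : ℕ} (h : n % 2 = 0) : ((n : ℕ) : ZMod 2) = 0 := by
  rw [← ZMod.natCast_mod n 2, h]; rfl

/-- ResponseDialA helper `castZ2_of_mod_eq_one` (decomp-qadv land package; see the module docstring). -/
theorem castZ2_of_mod_eq_one {n : ℕ} (h : n % 2 = 1) : ((n : ℕ) : ZMod 2) = 1 := by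
  rw [← ZMod.natCast_mod n 2, h]; rfl

/-- the sites already passed by position `k` form an initial segment: `[b_i + 1 ≤ k] = [i < g_k]`. -/
theorem side_eq {b : Fin 5 → ℕ} (hb : ∀ i j : Fin 5, i < j → b i + 2 ≤ b j) (k : ℕ) (i : Fin 5) :
    decide (b i + 1 ≤ k) = decide (i.val < (univ.filter fun i : Fin 5 => b i + 1 ≤ k).card) := by
  by_cases h : b i + 1 ≤ k
  · have hsub : Finset.Iic i ⊆ univ.filter fun i : Fin 5 => b i + 1 ≤ k := by
      intro j hj
      rw [Finset.mem_Iic] at hj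
      rw [mem_filter]
      refine ⟨mem_univ _, ?_⟩
      rcases lt_or_eq_of_le hj with hlt | heq
      · have := hb j i hlt; omega
      · rw [heq]; exact h
    have hc := card_le_card hsub
    rw [Fin.card_Iic] at hc
    rw [decide_eq_true h, decide_eq_true (by omega)]
  · have hsub : (univ.filter fun i : Fin 5 => b i + 1 ≤ k) ⊆ Finset.Iio i := by
      intro j hj
      rw [mem_filter] at hj
      rw [Finset.mem_Iio]
      by_contra hle
      push Not at hle
      rcases lt_or_eq_of_le hle with hlt | heq
      · have := hb i j hlt; omega
      · rw [heq] at h; exact h hj.2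
    have hc := card_le_card hsub
    rw [Fin.card_Iio] at hc
    rw [decide_eq_false h, decide_eq_false (by omega)]

/-- the orbit phase shift at position `k` is the group shift `sF z ε g_k`. -/
theorem shift_eq {b : Fin 5 → ℕ} (hb : ∀ i j : Fin 5, i < j → b i + 2 ≤ b j) (z ε : Fin 5 → Bool) (k : ℕ) :
    ∑ i : Fin 5, ct (ε i) (xor (z i) (decide (b i + 1 ≤ k))) =
      sF z ε (univ.filter fun i : Fin 5 => b i + 1 ≤ k).card := by
  have h := side_eq hb k
  rw [Fin.sum_univ_five, h 0, h 1, h 2, h 3, h 4]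
  rfl

/-- ResponseDialA helper `list_sum_swap` (decomp-qadv land package; see the module docstring). -/
theorem list_sum_swap {α : Type*} (Λ : List ℕ) (s : Finset α) (h : ℕ → α → ZMod 2) :
    (Λ.map fun j => ∑ k ∈ s, h j k).sum = ∑ k ∈ s, (Λ.map fun j => h j k).sum := by
  induction Λ with
  | nil => simp
  | cons a l ih => simp only [List.map_cons, List.sum_cons, ih, Finset.sum_add_distrib]

/-- ResponseDialA helper `list_sum_ite` (decomp-qadv land package; see the module docstring). -/
theorem list_sum_ite (Λ : List ℕ) (q : ℕ → Bool) :
    (Λ.map fun j => (if q j = true then (1 : ZMod 2) else 0)).sum = ((Λ.countP q : ℕ) : ZMod 2) := by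
  induction Λ with
  | nil => simp
  | cons a l ih =>
    rw [List.map_cons, List.sum_cons, ih, List.countP_cons]
    push_cast
    cases q a <;> simp [add_comm]

/-- additive response of the deviation set along the orbit, with response sets `R_i`. -/
def AddResp (b : Fin 5 → ℕ) (P : Fin N → CubeFn (ZMod 3) N) (R : Fin 5 → Finset (Fin N)) (x : Fin N → Bool) :
    Prop :=
  ∀ (ε : Fin 5 → Bool) (k : Fin N),
    k ∈ dev P (orbF b ε x) ↔ (k ∈ dev P x ↔ (univ.filter fun i : Fin 5 => ε i = true ∧ k ∈ R i).card % 2 = 0)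

/-- **THE ADDITIVE-RESPONSE ORBIT LAW**: an additively responding deviation set loses at one of the 32 orbit points
of five separated adjacent pair-flips — no gap, no degree, no density hypothesis. -/
theorem additive_orbit_loses (hN : 3 ≤ N) {b : Fin 5 → ℕ} (hb : ∀ i j : Fin 5, i < j → b i + 2 ≤ b j)
    (hbN : ∀ i, b i + 3 ≤ N) (P : Fin N → CubeFn (ZMod 3) N) (x : Fin N → Bool) (hx : OddZeros x)
    (R : Fin 5 → Finset (Fin N)) (hadd : AddResp b P R x) :
    ∃ ε : Fin 5 → Bool, ¬ Rel (orbF b ε x) (outB P (orbF b ε x)) := by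
  set z : Fin 5 → Bool := fun i => zpar x (b i + 1) with hz
  obtain ⟨hodd, hc1, hc2⟩ := certOK_lam z
  by_contra hall
  push Not at hall
  set gk : Fin N → ℕ := fun k => (univ.filter fun i : Fin 5 => b i + 1 ≤ k.val).card with hgk
  have hgk6 : ∀ k, gk k < 6 := fun k =>
    Nat.lt_succ_of_le (le_trans (card_le_univ _) (by simp))
  set c : Fin N → ZMod 3 := fun k => ((cN x k.val : ℕ) : ZMod 3) with hc
  -- the win parity at each orbit point, decomposed additively (in 𝔽₂)
  have hW : ∀ ε : Fin 5 → Bool,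
      (∑ k : Fin N, (if k ∈ dev P x ∧ c k + sF z ε (gk k) ≠ 2 then (1 : ZMod 2) else 0)) +
        ∑ i : Fin 5, ∑ k : Fin N,
          (if ε i = true ∧ k ∈ R i ∧ c k + sF z ε (gk k) ≠ 2 then (1 : ZMod 2) else 0) = 1 := by
    intro ε
    have ho : OddZeros (orbF b ε x) := (oddZeros_orbF hbN ε x).2 hx
    have hwin := (win_iff hN P _ ho).1 (hall ε)
    have hphase : ∀ k : Fin N, gCond (orbF b ε x) k.val ↔ c k + sF z ε (gk k) ≠ 2 := by
      intro k
      rw [gCond_iff_cN, mod3_ne_two, cN_orbF_cast x hb hbN ε k.val (le_of_lt k.isLt), shift_eq hb]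
    have hfilt : ((dev P (orbF b ε x)).filter fun k => gCond (orbF b ε x) k.val) =
        univ.filter fun k => k ∈ dev P (orbF b ε x) ∧ c k + sF z ε (gk k) ≠ 2 := by
      ext k
      rw [mem_filter, mem_filter, hphase k]
      simp only [mem_univ, true_and]
    rw [hfilt] at hwin
    have h1 : (((univ.filter fun k =>
        k ∈ dev P (orbF b ε x) ∧ c k + sF z ε (gk k) ≠ 2).card : ℕ) : ZMod 2) = 1 := castZ2_of_mod_eq_one hwin
    rw [natCast_card_filter] at h1
    refine Eq.trans ?_ h1
    rw [sum_comm, ← sum_add_distrib]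
    refine sum_congr rfl fun k _ => ?_
    -- pointwise: [k ∈ D ∧ φ] + Σ_i [ε_i ∧ k ∈ R_i ∧ φ] = [k ∈ D^ε ∧ φ]
    by_cases hφ : c k + sF z ε (gk k) = 2
    · simp [hφ]
    · have hk := hadd ε k
      have hcnt : ∑ i : Fin 5, (if ε i = true ∧ k ∈ R i ∧ c k + sF z ε (gk k) ≠ 2 then (1 : ZMod 2) else 0) =
          (((univ.filter fun i : Fin 5 => ε i = true ∧ k ∈ R i).card : ℕ) : ZMod 2) := by
        rw [natCast_card_filter]
        refine sum_congr rfl fun i _ => ?_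
        by_cases h1 : ε i = true ∧ k ∈ R i
        · rw [if_pos ⟨h1.1, h1.2, hφ⟩, if_pos h1]
        · rw [if_neg (fun h => h1 ⟨h.1, h.2.1⟩), if_neg h1]
      rw [hcnt]
      rcases Nat.mod_two_eq_zero_or_one (univ.filter fun i : Fin 5 => ε i = true ∧ k ∈ R i).card with he | he
      · rw [castZ2_of_mod_eq_zero he]
        have hiff : k ∈ dev P (orbF b ε x) ↔ k ∈ dev P x := by
          rw [hk]; exact ⟨fun h => h.2 he, fun h => ⟨fun _ => he, fun _ => h⟩⟩
        by_cases hD : k ∈ dev P x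
        · have hDε : k ∈ dev P (orbF b ε x) := hiff.2 hD
          simp [hD, hφ, hDε]
        · have hDε : k ∉ dev P (orbF b ε x) := fun h => hD (hiff.1 h)
          simp [hD, hφ, hDε]
      · rw [castZ2_of_mod_eq_one he]
        have hne : ¬ ((univ.filter fun i : Fin 5 => ε i = true ∧ k ∈ R i).card % 2 = 0) := by omega
        by_cases hD : k ∈ dev P x
        · have hDε : k ∉ dev P (orbF b ε x) := fun h => hne ((hk.1 h).1 hD)
          simp [hD, hφ, hDε]
          decide
        · have hDε : k ∈ dev P (orbF b ε x) := hk.2 ⟨fun h => absurd h hD, fun h => absurd h hne⟩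
          simp [hD, hφ, hDε]
  -- sum the win parities over the certificate
  have hL : ((lam z).map fun j =>
      (∑ k : Fin N, (if k ∈ dev P x ∧ c k + sF z (εOf j) (gk k) ≠ 2 then (1 : ZMod 2) else 0)) +
        ∑ i : Fin 5, ∑ k : Fin N,
          (if εOf j i = true ∧ k ∈ R i ∧ c k + sF z (εOf j) (gk k) ≠ 2 then (1 : ZMod 2) else 0)).sum =
      ((lam z).map fun _ => (1 : ZMod 2)).sum := by
    congr 1
    exact List.map_congr_left fun j _ => hW (εOf j)
  have hR : ((lam z).map fun _ => (1 : ZMod 2)).sum = 1 := by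
    rw [List.map_const', List.sum_replicate, nsmul_eq_mul, mul_one]
    exact castZ2_of_mod_eq_one hodd
  rw [hR, List.sum_map_add] at hL
  -- first part: per position, an even count over the certificate
  have hA : ((lam z).map fun j =>
      ∑ k : Fin N, (if k ∈ dev P x ∧ c k + sF z (εOf j) (gk k) ≠ 2 then (1 : ZMod 2) else 0)).sum = 0 := by
    rw [list_sum_swap]
    refine sum_eq_zero fun k _ => ?_
    by_cases hD : k ∈ dev P x
    · have h0 : ((lam z).map fun j =>
          if decide (c k + sF z (εOf j) (gk k) ≠ 2) = true then (1 : ZMod 2) else 0).sum = 0 := by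
        rw [list_sum_ite]; exact castZ2_of_mod_eq_zero (hc1 ⟨gk k, hgk6 k⟩ (c k))
      refine Eq.trans ?_ h0
      congr 1
      refine List.map_congr_left fun j _ => ?_
      by_cases h : c k + sF z (εOf j) (gk k) = 2 <;> simp [h, hD]
    · have : ∀ j ∈ lam z, (if k ∈ dev P x ∧ c k + sF z (εOf j) (gk k) ≠ 2 then (1 : ZMod 2) else 0) = 0 :=
        fun j _ => if_neg (fun h => hD h.1)
      rw [List.map_congr_left this]
      simp
  have hB : ((lam z).map fun j => ∑ i : Fin 5, ∑ k : Fin N,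
      (if εOf j i = true ∧ k ∈ R i ∧ c k + sF z (εOf j) (gk k) ≠ 2 then (1 : ZMod 2) else 0)).sum = 0 := by
    rw [list_sum_swap]
    refine sum_eq_zero fun i _ => ?_
    rw [list_sum_swap]
    refine sum_eq_zero fun k _ => ?_
    by_cases hRk : k ∈ R i
    · have h0 : ((lam z).map fun j =>
          if (εOf j i && decide (c k + sF z (εOf j) (gk k) ≠ 2)) = true then (1 : ZMod 2) else 0).sum = 0 := by
        rw [list_sum_ite]; exact castZ2_of_mod_eq_zero (hc2 i ⟨gk k, hgk6 k⟩ (c k))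
      refine Eq.trans ?_ h0
      congr 1
      refine List.map_congr_left fun j _ => ?_
      by_cases h : c k + sF z (εOf j) (gk k) = 2 <;> cases εOf j i <;> simp [h, hRk]
    · have : ∀ j ∈ lam z, (if εOf j i = true ∧ k ∈ R i ∧ c k + sF z (εOf j) (gk k) ≠ 2
          then (1 : ZMod 2) else 0) = 0 := fun j _ => if_neg (fun h => hRk h.2.1)
      rw [List.map_congr_left this]
      simp
  rw [hA, hB, add_zero] at hL
  exact zero_ne_one hL

/-- thirty-two-fold union bound along the orbit. -/
theorem card_exists_orbF_le (b : Fin 5 → ℕ) (Q : (Fin N → Bool) → Prop) [DecidablePred Q] :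
    (univ.filter fun x : Fin N → Bool => ∃ ε : Fin 5 → Bool, Q (orbF b ε x)).card
      ≤ 32 * (univ.filter fun x => Q x).card := by
  calc (univ.filter fun x : Fin N → Bool => ∃ ε : Fin 5 → Bool, Q (orbF b ε x)).card
      ≤ (univ.biUnion fun ε : Fin 5 → Bool => univ.filter fun x : Fin N → Bool => Q (orbF b ε x)).card := by
        refine card_le_card fun x hx => ?_
        rw [mem_filter] at hx
        obtain ⟨ε, hε⟩ := hx.2
        rw [mem_biUnion]
        exact ⟨ε, mem_univ _, mem_filter.2 ⟨mem_univ _, hε⟩⟩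
    _ ≤ ∑ ε : Fin 5 → Bool, (univ.filter fun x : Fin N → Bool => Q (orbF b ε x)).card := card_biUnion_le
    _ = ∑ ε : Fin 5 → Bool, (univ.filter fun x => Q x).card := by
        refine sum_congr rfl fun ε _ => ?_
        exact card_filter_orbF Q b ε
    _ = 32 * (univ.filter fun x => Q x).card := by
        rw [sum_const, card_univ, smul_eq_mul]
        norm_num [Fintype.card_fun, Fintype.card_bool, Fintype.card_fin]

/-- **THE ADDITIVE-RESPONSE ORBIT LAW (counting)**: `#{odd, additively responding} ≤ 32 · #{odd losers}`. -/
theorem additive_loss_count (hN : 3 ≤ N) {b : Fin 5 → ℕ} (hb : ∀ i j : Fin 5, i < j → b i + 2 ≤ b j)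
    (hbN : ∀ i, b i + 3 ≤ N) (P : Fin N → CubeFn (ZMod 3) N) :
    (univ.filter fun x : Fin N → Bool =>
        OddZeros x ∧ ∃ R : Fin 5 → Finset (Fin N), AddResp b P R x).card ≤
      32 * (univ.filter fun x : Fin N → Bool => OddZeros x ∧ ¬ Rel x (outB P x)).card := by
  refine le_trans (card_le_card fun x hx => ?_)
    (card_exists_orbF_le b (fun y : Fin N → Bool => OddZeros y ∧ ¬ Rel y (outB P y)))
  rw [mem_filter] at hx ⊢
  obtain ⟨-, hodd, R, hR⟩ := hx
  obtain ⟨ε, hε⟩ := additive_orbit_loses hN hb hbN P x hodd R hR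
  exact ⟨mem_univ _, ε, (oddZeros_orbF hbN ε x).2 hodd, hε⟩

end Law


end Summit.QuantumAdvantage.QuantumAdvantage.Theorems.ResponseDial
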